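import Summits.BirchSwinnertonDyer.Rank1Residual.Additive.X4SharpUnitFreeResidueSharp
import Literature.NumberTheory.EllipticCurves.Wuthrich2014.ThreeAdicImageOrdinaryProofs
import HarnessLib

/-!
# The `3`-adic TOWER on the semistable-twist locus of X4 at `p = 3` is CERTIFICATE-FREE:
# `ρ̄_{E,3}` onto ⟹ `ρ̄_{E,3ⁿ}` onto for all `n` on (M) ∪ (G-ord, `e = 2`), and the N11 consumers
# (cell `b2b-bsdres`, team n1011, seat p14, OWNERS row T-b1 kernel piece)

HONEST FRAMING (cell `b2b-bsdres`, run/shared/lean/b2b/bsd-rank1-residual/, verbatim in every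
file): the goal of the cell is to DELETE the COMBINATION-SHAPED residual classes of the
Birch–Swinnerton-Dyer formula for ALL analytic-rank `≤ 1` elliptic curves over `ℚ` — "full BSD
formula for every rank `≤ 1` curve in class `C`" assembled STRICTLY from published theorems — so
that the rank-`≤ 1` remainder becomes exactly the CONSTRUCTION-SHAPED classes, which are TYPED
(missing-input `Prop`s), NOT attempted. This is not "finishing BSD". Team n1011 (N10 / N11, the
additive block X4 ∧ `p = 3`): research route on the CONSTRUCTION-SHAPED class X4; no claim beyond the
stated classes; the label X4 is UNCHANGED by this file; nothing is booked. Theorems only (no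
definition, no named fact minted; every published input is an explicit named-fact hypothesis).

## What this file proves

On the residue block N11 (X4 ∧ `r_an = 0` ∧ `p = 3` ∧ surj(3)) two published UPPER-HALF routes
need the `3`-adic TOWER `∀ n, ρ̄_{E,3ⁿ}` onto (Kato's (12.5.2)): Kato 2004 Thm. 17.4 (3) on the
`ω^{(p−1)/2}`-component for the semistable twist `E♭ = E^{(−3)}` (seats additive-p1, additive-p2, additive-p4:
`ClassX4M.missingUpperBoundAt_three_rankZero_of_surj`, `ClassX4Gord.…_of_katoComponent_of_towerSurj`)
and Kato Thm. 14.5 (3) on `E` itself (V20). So far the tower came from Wuthrich 2014 Lemma 20 as a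
NAMED FACT (`hL20`, registry A9) on the (M) rows, and from a per-pair CERTIFICATE (`Ram W 3`, a
`j`-witness, or surj(9)) on the (G-ord, `e = 2`) rows. Seat lit-kato gen 7 PROVED Lemma 20 on the
good-ORDINARY and MULTIPLICATIVE loci (`WeierstrassCurve.forall_hasSurjectiveModNGaloisRep_pow_of_
{goodOrdinary,multiplicative}_of_surj`, p247422/p248058: Serre–Tate / Tate line + a first-order
witness; no Elkies parametrisation). Applied to the semistable twist MODEL `V` (`C • V^{(p*)} = W`,
`V` multiplicative at `p` on (M) — `PotMult.mult_of_twist_model_pStar` — resp. good ordinary on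
(G-ord, `e = 2`) — `ClassX4Gord.exists_goodOrd_pStar_twist_model`) and transported back along the
twist (`GaloisImage.hasSurjectiveModNGaloisRep_pow_iff_of_model_twist`: a quadratic twist changes
`ρ̄_{E,pⁿ}` by a sign), this gives, at every odd `p` and in particular at `p = 3`:

* §1 `AdditivePotMult.PotMult.towerSurj_twist_of_surj`, `….towerSurj_of_surj`,
  `Additive.TypeGOrd.towerSurj_of_surj_of_two`, `ClassX4Gord.towerSurj_of_surj`,
  `ClassX4M.towerSurj_of_surj`: **surj(p) ⟹ tower**, with NO certificate and NO `hL20`, on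
  (M) ∪ (G-ord, `e = 2`);
* §2 (G-ord, `e = 2`), every odd `p`: `ClassX4Gord.missingUpperBoundAt_rankZero_of_katoComponent_of_surj`
  (the V24 theorem `…_of_towerSurj` with the tower DISCHARGED: NO `Ram W 3`, NO `j`-witness, NO
  surj(9), NO Tamagawa, NO Manin), `…bsdp_rankZero_of_katoComponent_of_surj_of_shaAn_unit`,
  `…missingInputAt_iff_lower_rankZero_of_katoComponent_of_surj`;
* (sibling file `Additive/X4MThreeUpperHalfTowerFree.lean`: additive-p1's (M)@3 rank-0 chain
  `ClassX4M.missingUpperBoundAt_three_rankZero_of_surj` & co. with the `hL20` binder REMOVED);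
* §3 the EXOTIC residue piece of the end-state `x4SharpUnitFree_iff_lower_and_residues_sharp`
  (`p = 3`, potentially good, tower fails) is DISJOINT from (G-ord, `e = 2`):
  `not_typeGOrd_two_of_not_towerSurj`, and `ClassX4Gord.missingUpperBoundAt_rankZero_of_katoComponent_of_exotic`
  loses its `hexotic` hypothesis (it is §2).

Census pointer (numbers of record are the census files', not this docstring's): RESIDUAL-MAP §I N11
— of the 192 277 S-b X4 ∧ `p = 3` ∧ `r_an = 0` ∧ surj(3) pairs, 82 103 are (M)@3 and 16 517 are
potentially good ordinary at 3 (rmap-2 GEN 2/3); on the (M) ∪ (G-ord, `e = 2`) part the tower bit of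
the sub-partition (CLASS-CLOSURE-PLAN §3.1 E2 (a)) is now decided by surj(3) alone. X4 stays
CONSTRUCTION-SHAPED (the LOWER half `MissingLowerBoundAt W 3` is untouched); nothing booked.

References: Wuthrich 2014 [Wuthrich2014] Lemma 20 (p. 399); Kato 2004 [Kato2004Asterisque] Thm. 17.4
(3) (p. 273), (12.5.2) (p. 222); Delbourgo 1998 [Delbourgo1998] Prop. 4 (p. 144); Greenberg 1991
[Greenberg1991] §2; Serre 1968 [SerreAbelianLadic1968] IV-23 Lemma 3; Silverman *AEC* X.5 Cor. 5.4,
*ATAEC* V.5.3; Miller 2011 [Miller2011LMS] Def. 1.1.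
-/

noncomputable section

open scoped Classical

open WeierstrassCurve Literature.NumberTheory.EllipticCurves
  Literature.NumberTheory.EllipticCurves.ModularForms
  Literature.NumberTheory.EllipticCurves.Rank1Residual
  Literature.NumberTheory.EllipticCurves.Rank1Residual.Typed

/-! ### §1 The tower on the semistable-twist locus from surj(p) alone -/

namespace Summit.BirchSwinnertonDyer.Rank1Residual.AdditivePotMult

open Additive

variable {W : WeierstrassCurve ℚ} [W.IsElliptic] {p : ℕ} [hp : Fact p.Prime]

/-- **(M), any twist model: `ρ̄_{V,pⁿ}` onto for all `n` from surj(p) of `E` — NO `hL20`.** If `E/ℚ`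
(`W`) is additive potentially multiplicative at the odd prime `p`, `ρ̄_{E,p}` is onto, and `V/ℚ` is
ANY Weierstrass model with `C • V^{(p*)} = W` (`p* = (−1)^{⌊p/2⌋} p`), then `ρ̄_{V,pⁿ}` is onto for
every `n`: `V` is multiplicative at `p` (`PotMult.mult_of_twist_model_pStar`), `ρ̄_{V,p}` is onto iff
`ρ̄_{W,p}` is (`surj_iff_of_model_twist`), and lit-kato's PROVED multiplicative case of Wuthrich's
Lemma 20 (`forall_hasSurjectiveModNGaloisRep_pow_of_multiplicative_of_surj`: Tate line + first-order
witness) lifts surj(p) up the tower. [cite: Wuthrich2014, Lemma 20 (p. 399)]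
[cite: SerreAbelianLadic1968, IV A.1.2–A.1.3 and IV-23 Lemma 3] [cite: SilvermanATAEC1994, V.5.3] -/
theorem PotMult.towerSurj_twist_of_surj (hpm : PotMult W p) (hp2 : p ≠ 2) (hsurj : Surj W p)
    (V : WeierstrassCurve ℚ) [V.IsElliptic] (C : VariableChange ℚ)
    (hC : C • V.quadraticTwist ((-1 : ℚ) ^ (p / 2) * p) = W) (n : ℕ) :
    V.HasSurjectiveModNGaloisRep (p ^ n : ℕ) := by
  have hV : Mult V p := hpm.mult_of_twist_model_pStar hp2 V C hC
  have hsV : Surj V p := (surj_iff_of_model_twist V p (pStar_ne_zero p) ⟨C, hC⟩).mp hsurj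
  exact V.forall_hasSurjectiveModNGaloisRep_pow_of_multiplicative_of_surj p hp2 hV hsV n

/-- **(M) at `p = 3`, twist models `C • V^{(−3)} = W`: `ρ̄_{V,3ⁿ}` onto for all `n` from surj(3)** —
the binder shape of additive-p1's `PotMult.forall_surj_pow_three_twist_of_surj` with the named fact
`hL20` (Wuthrich 2014 Lemma 20, registry A9) REMOVED. [cite: Wuthrich2014, Lemma 20 (p. 399)]
[cite: SerreAbelianLadic1968, IV A.1.2–A.1.3] -/
theorem PotMult.towerSurj_twist_negThree_of_surj (hpm : PotMult W 3) (hsurj : Surj W 3)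
    (V : WeierstrassCurve ℚ) [V.IsElliptic] (C : VariableChange ℚ)
    (hC : C • V.quadraticTwist (-3 : ℚ) = W) (n : ℕ) :
    V.HasSurjectiveModNGaloisRep (3 ^ n : ℕ) :=
  hpm.towerSurj_twist_of_surj (by norm_num) hsurj V C (by norm_num [hC]) n

/-- **(M): the tower of `E` itself from surj(p)** (`p` odd): `PotMult W p ∧ Surj W p ⟹ ρ̄_{E,pⁿ}`
onto for every `n` — the twist model's tower (`towerSurj_twist_of_surj`, on the globally minimal
model of `E^{(p*)}`, `PotMult.exists_mult_pStar_twist_model`) transported along the quadratic twist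
(`GaloisImage.hasSurjectiveModNGaloisRep_pow_iff_of_model_twist`). This is Kato's (12.5.2) for `E`
on the (M) rows with NO certificate. [cite: Wuthrich2014, Lemma 20 (p. 399)]
[cite: Kato2004Asterisque, (12.5.2) in Thm. 12.5 (4) (p. 222)] [cite: SilvermanAEC2009, X.5 Cor. 5.4] -/
theorem PotMult.towerSurj_of_surj (hpm : PotMult W p) (hp2 : p ≠ 2) (hsurj : Surj W p) (n : ℕ) :
    W.HasSurjectiveModNGaloisRep (p ^ n : ℕ) := by
  obtain ⟨V, iV, -, C, -, hC⟩ := hpm.exists_mult_pStar_twist_model hp2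
  exact (GaloisImage.hasSurjectiveModNGaloisRep_pow_iff_of_model_twist V p (pStar_ne_zero p)
    ⟨C, hC⟩ n).mpr (hpm.towerSurj_twist_of_surj hp2 hsurj V C hC n)

/-- **X4(M): the tower of `E` from the census bit surj(p)** (inside `ClassX4` only `Irr` is recorded;
`Surj W p` is the extra bit; `p` odd is part of `ClassX4`). [cite: Wuthrich2014, Lemma 20 (p. 399)]
[cite: Kato2004Asterisque, (12.5.2) in Thm. 12.5 (4) (p. 222)] -/
theorem ClassX4M.towerSurj_of_surj (hX : ClassX4M W p) (hsurj : Surj W p) (n : ℕ) :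
    W.HasSurjectiveModNGaloisRep (p ^ n : ℕ) :=
  (ClassX4M.potMult W p hX).towerSurj_of_surj hX.p_ne_two hsurj n

/-- **X4(M) at `p = 3`, twist models `C • V^{(−3)} = W`: the tower of `V` from surj(3)** — drop-in
for additive-p1's `ClassX4M.forall_surj_pow_three_twist_of_surj` minus `hL20`.
[cite: Wuthrich2014, Lemma 20 (p. 399)] -/
theorem ClassX4M.towerSurj_twist_negThree_of_surj (hX : ClassX4M W 3) (hsurj : Surj W 3)
    (V : WeierstrassCurve ℚ) [V.IsElliptic] (C : VariableChange ℚ)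
    (hC : C • V.quadraticTwist (-3 : ℚ) = W) (n : ℕ) :
    V.HasSurjectiveModNGaloisRep (3 ^ n : ℕ) :=
  (ClassX4M.potMult W 3 hX).towerSurj_twist_negThree_of_surj hsurj V C hC n

end Summit.BirchSwinnertonDyer.Rank1Residual.AdditivePotMult

namespace Summit.BirchSwinnertonDyer.Rank1Residual.Additive

variable {W : WeierstrassCurve ℚ} [W.IsElliptic] [W.IsGloballyMinimal] {p : ℕ} [hp : Fact p.Prime]

/-- **(G-ord, `e = 2`): the tower of `E` from surj(p) alone** (`p` odd). For `E/ℚ` additive at `p`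
of type (G)-ordinary with semistability defect `e = 2` (Kodaira `I₀*`, good ORDINARY twist) and
`ρ̄_{E,p}` onto, `ρ̄_{E,pⁿ}` is onto for every `n`: the globally minimal good-ordinary model `V` of
`E^{(p*)}` (`TypeGOrd.exists_goodOrd_pStar_twist_model`) has `ρ̄_{V,p}` onto
(`surj_iff_of_model_twist`), hence its whole tower by lit-kato's PROVED good-ordinary case of
Wuthrich's Lemma 20 (`forall_hasSurjectiveModNGaloisRep_pow_of_goodOrdinary_of_surj`: Serre–Tate line
+ first-order witness), transported back along the twist
(`GaloisImage.hasSurjectiveModNGaloisRep_pow_iff_of_model_twist`). NO (ram), NO `j`-witness, NO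
surj(9) certificate. [cite: Wuthrich2014, Lemma 20 (p. 399)] [cite: Greenberg1991, §2 (p. 214)]
[cite: SerreAbelianLadic1968, Ch. IV §3.4, Lemma 3 (IV-23)] [cite: SilvermanAEC2009, X.5 Cor. 5.4] -/
theorem TypeGOrd.towerSurj_of_surj_of_two (hp2 : p ≠ 2) (hG : TypeGOrd W p) (hadd : Addv W p)
    (he : semistabilityIndex W p = 2) (hsurj : Surj W p) (n : ℕ) :
    W.HasSurjectiveModNGaloisRep (p ^ n : ℕ) := by
  obtain ⟨V, iV, iVm, C, hV, hC⟩ := TypeGOrd.exists_goodOrd_pStar_twist_model W p hp2 hG hadd he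
  have hsV : Surj V p := (surj_iff_of_model_twist V p (pStar_ne_zero p) ⟨C, hC⟩).mp hsurj
  exact (GaloisImage.hasSurjectiveModNGaloisRep_pow_iff_of_model_twist V p (pStar_ne_zero p)
    ⟨C, hC⟩ n).mpr
    (V.forall_hasSurjectiveModNGaloisRep_pow_of_goodOrdinary_of_surj p hp2 hV.1 hV.2 hsV n)

/-- **X4♯(G-ord) ∩ `I₀*`: the tower of `E` from the census bit surj(p)** — every odd `p`, in
particular `p = 3` (at `p ≥ 5` this is also Serre's `surj(p) ⟹ GL₂(ℤ_p)`).
[cite: Wuthrich2014, Lemma 20 (p. 399)] [cite: Kato2004Asterisque, (12.5.2) in Thm. 12.5 (4) (p. 222)] -/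
theorem ClassX4Gord.towerSurj_of_surj (hX : ClassX4Gord W p) (he : semistabilityIndex W p = 2)
    (hsurj : Surj W p) (n : ℕ) : W.HasSurjectiveModNGaloisRep (p ^ n : ℕ) :=
  TypeGOrd.towerSurj_of_surj_of_two hX.addv.1 hX.typeGOrd hX.addv.2 he hsurj n

/-- **The semistable-twist locus of X4: surj(p) ⟹ tower** — on an X4 pair that is potentially
multiplicative (`ord_p j < 0`) OR potentially good ordinary of defect `2`, `ρ̄_{E,p}` onto gives
`ρ̄_{E,pⁿ}` onto for all `n`, with no certificate. [cite: Wuthrich2014, Lemma 20 (p. 399)]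
[cite: Kato2004Asterisque, (12.5.2) in Thm. 12.5 (4) (p. 222)] -/
theorem ClassX4.towerSurj_of_surj_of_potMult_or_typeGOrd_two (hX : ClassX4 W p)
    (hsst : padicValRat p W.j < 0 ∨ (TypeGOrd W p ∧ semistabilityIndex W p = 2))
    (hsurj : Surj W p) (n : ℕ) : W.HasSurjectiveModNGaloisRep (p ^ n : ℕ) := by
  rcases hsst with hneg | ⟨hG, he⟩
  · exact AdditivePotMult.ClassX4M.towerSurj_of_surj ⟨hX, hX.2.1, hneg⟩ hsurj n
  · exact ClassX4Gord.towerSurj_of_surj ⟨hX, hG⟩ he hsurj n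

/-! ### §2 (G-ord, `e = 2`), rank `0`: the upper half from surj(p) with NO certificate -/

/-- **X4♯(G-ord) ∩ `I₀*`, `r_an = 0`, surj(p): the UPPER half `ord_p #Ш(E) ≤ ord_p #Ш_an(E)` from
named facts alone at EVERY odd `p`, `p = 3` INCLUDED, with NO (ram), NO `j`-witness, NO surj(9),
NO Tamagawa, NO Manin hypothesis** — the V24 theorem
`ClassX4Gord.missingUpperBoundAt_rankZero_of_katoComponent_of_towerSurj` (Kato 2004 Thm. 17.4 (3) on
the `ω^{(p−1)/2}`-component for the good ordinary twist, `hK`; Delbourgo 1998 Prop. 4 `hDel`; GZK;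
modularity `hmod`/`hmodD`) fed with the certificate-free tower of §1. This removes the `hram3`
premise of additive-p2's `…_of_katoComponent` and the `hexotic` premise of additive-p4's
`…_of_katoComponent_of_exotic`. X4♯(G-ord) stays CONSTRUCTION-SHAPED (the lower half is the located
gap). [cite: Kato2004Asterisque, Thm. 17.4 (3) (p. 273)] [cite: Delbourgo1998, Prop. 4 (p. 144)]
[cite: Wuthrich2014, Lemma 20 (p. 399)] [cite: Miller2011LMS, Def. 1.1] -/
theorem ClassX4Gord.missingUpperBoundAt_rankZero_of_katoComponent_of_surj
    (hK : Kato2004.charIdeal_dvd_padicLFunctionBranch_component_of_surjective)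
    (hDel : Delbourgo1998.prop4_rankZero_pow_dvd_constantCoeff)
    (hGZK : rank_eq_analyticRank_of_analyticRank_le_one) (hmod : hasEntireLFunction_rat)
    (hmodD : nonempty_modularParametrizationData)
    (hX : ClassX4Gord W p) (he : semistabilityIndex W p = 2) (hr : W.analyticRank = 0)
    (hsurj : Surj W p) : MissingUpperBoundAt W p :=
  ClassX4Gord.missingUpperBoundAt_rankZero_of_katoComponent_of_towerSurj hK hDel hGZK hmod hmodD hX he
    hr (ClassX4Gord.towerSurj_of_surj hX he hsurj)

/-- **`BSD(E,p)` on X4♯(G-ord) ∩ `I₀*` ∧ `r_an = 0` ∧ surj(p) ∧ `p ∤ #Ш_an(E)`**, every odd `p`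
(`p = 3` included), with NO certificate, NO Tamagawa, NO Manin hypothesis.
[cite: Kato2004Asterisque, Thm. 17.4 (3) (p. 273)] [cite: Delbourgo1998, Prop. 4 (p. 144)]
[cite: Miller2011LMS, §1 and Def. 1.1] -/
theorem ClassX4Gord.bsdp_rankZero_of_katoComponent_of_surj_of_shaAn_unit
    (hK : Kato2004.charIdeal_dvd_padicLFunctionBranch_component_of_surjective)
    (hDel : Delbourgo1998.prop4_rankZero_pow_dvd_constantCoeff)
    (hGZK : rank_eq_analyticRank_of_analyticRank_le_one) (hmod : hasEntireLFunction_rat)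
    (hmodD : nonempty_modularParametrizationData)
    (hX : ClassX4Gord W p) (he : semistabilityIndex W p = 2) (hr : W.analyticRank = 0)
    (hsurj : Surj W p) {q : ℚ} (hq : shaAn W = (q : ℂ)) (hv : padicValRat p q = 0) : BSDp W p :=
  ClassX4Gord.bsdp_rankZero_of_katoComponent_of_towerSurj_of_shaAn_unit hK hDel hGZK hmod hmodD hX he
    hr (ClassX4Gord.towerSurj_of_surj hX he hsurj) hq hv

/-- **X4♯(G-ord) ∩ `I₀*` ∧ `r_an = 0` ∧ surj(p): what remains of X4♯ is EXACTLY the lower half**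
(`Typed.X4.MissingInputAt W p ↔ MissingLowerBoundAt W p`), every odd `p`, no certificate.
[cite: Kato2004Asterisque, Thm. 17.4 (3) (p. 273)] [cite: Delbourgo1998, Prop. 4 (p. 144)] -/
theorem ClassX4Gord.missingInputAt_iff_lower_rankZero_of_katoComponent_of_surj
    (hK : Kato2004.charIdeal_dvd_padicLFunctionBranch_component_of_surjective)
    (hDel : Delbourgo1998.prop4_rankZero_pow_dvd_constantCoeff)
    (hGZK : rank_eq_analyticRank_of_analyticRank_le_one) (hmod : hasEntireLFunction_rat)
    (hmodD : nonempty_modularParametrizationData)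
    (hX : ClassX4Gord W p) (he : semistabilityIndex W p = 2) (hr : W.analyticRank = 0)
    (hsurj : Surj W p) : X4.MissingInputAt W p ↔ MissingLowerBoundAt W p :=
  ClassX4Gord.missingInputAt_iff_lower_rankZero_of_katoComponent_of_towerSurj hK hDel hGZK hmod hmodD
    hX he hr (ClassX4Gord.towerSurj_of_surj hX he hsurj)

/-- **`BSD(E,p)` on X4♯(G-ord) ∩ `I₀*` ∧ `r_an = 0` ∧ surj(p) from the LOWER half** (the
`p ∣ #Ш_an` rows), every odd `p`, no certificate. [cite: Kato2004Asterisque, Thm. 17.4 (3) (p. 273)]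
[cite: Delbourgo1998, Prop. 4 (p. 144)] [cite: Miller2011LMS, §1 and Def. 1.1] -/
theorem ClassX4Gord.bsdp_rankZero_of_katoComponent_of_surj_of_lower
    (hK : Kato2004.charIdeal_dvd_padicLFunctionBranch_component_of_surjective)
    (hDel : Delbourgo1998.prop4_rankZero_pow_dvd_constantCoeff)
    (hGZK : rank_eq_analyticRank_of_analyticRank_le_one) (hmod : hasEntireLFunction_rat)
    (hmodD : nonempty_modularParametrizationData)
    (hX : ClassX4Gord W p) (he : semistabilityIndex W p = 2) (hr : W.analyticRank = 0)
    (hsurj : Surj W p) (hlow : MissingLowerBoundAt W p) : BSDp W p :=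
  bsdp_of_missingPPartAt W p hGZK (by rw [hr]; exact zero_le_one)
    (missingPPartAt_of_lower_of_upper W p hlow
      (ClassX4Gord.missingUpperBoundAt_rankZero_of_katoComponent_of_surj hK hDel hGZK hmod hmodD hX he
        hr hsurj))

end Summit.BirchSwinnertonDyer.Rank1Residual.Additive

/-! ### §3 The EXOTIC residue piece is disjoint from (G-ord, `e = 2`) -/

namespace Summit.BirchSwinnertonDyer.Rank1Residual.Additive

variable {W : WeierstrassCurve ℚ} [W.IsElliptic] [W.IsGloballyMinimal] {p : ℕ} [hp : Fact p.Prime]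

/-- **An X4 pair with `ρ̄_{E,p}` onto whose tower FAILS is neither potentially multiplicative nor
potentially good ordinary of defect `2`** (every odd `p`; by Serre such a pair has `p = 3`): the
EXOTIC residue piece of `x4SharpUnitFree_iff_lower_and_residues_sharp` (`p = 3`, `ord₃ j ≥ 0`,
`ρ̄_{E,3ⁿ}` not onto for some `n`) lies inside the (G-ord, `e ≠ 2`) ∪ (G-supersingular) rows.
[cite: Wuthrich2014, Lemma 20 (p. 399)] [cite: Kato2004Asterisque, (12.5.2) in Thm. 12.5 (4) (p. 222)] -/
theorem ClassX4.not_potMult_and_not_typeGOrd_two_of_not_towerSurj (hX : ClassX4 W p)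
    (hsurj : Surj W p) (hnot : ¬ ∀ n : ℕ, W.HasSurjectiveModNGaloisRep (p ^ n : ℕ)) :
    ¬ padicValRat p W.j < 0 ∧ ¬ (TypeGOrd W p ∧ semistabilityIndex W p = 2) :=
  ⟨fun hneg ↦ hnot (ClassX4.towerSurj_of_surj_of_potMult_or_typeGOrd_two hX (Or.inl hneg) hsurj),
    fun hG ↦ hnot (ClassX4.towerSurj_of_surj_of_potMult_or_typeGOrd_two hX (Or.inr hG) hsurj)⟩

/-- **The EXOTIC hypothesis of the end-state, RESTRICTED**: the EXOTIC piece (`p = 3`, pot. good,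
surj(3), tower fails ⟹ upper half) is EQUIVALENT to the same statement on the rows that are NOT
(G-ord, `e = 2`) — on (G-ord, `e = 2`) the premise "tower fails" is contradictory (§1).
[cite: Wuthrich2014, Lemma 20 (p. 399)] [cite: Miller2011LMS, Def. 1.1] -/
theorem exotic_iff_exotic_of_not_typeGOrd_two :
    (∀ (W : WeierstrassCurve ℚ) [W.IsElliptic] [W.IsGloballyMinimal],
        W.analyticRank = 0 → ClassX4 W 3 → Surj W 3 → 0 ≤ padicValRat 3 W.j →
        ¬ (∀ n : ℕ, W.HasSurjectiveModNGaloisRep (3 ^ n : ℕ)) → MissingUpperBoundAt W 3) ↔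
    (∀ (W : WeierstrassCurve ℚ) [W.IsElliptic] [W.IsGloballyMinimal],
        W.analyticRank = 0 → ClassX4 W 3 → Surj W 3 → 0 ≤ padicValRat 3 W.j →
        ¬ (TypeGOrd W 3 ∧ semistabilityIndex W 3 = 2) →
        ¬ (∀ n : ℕ, W.HasSurjectiveModNGaloisRep (3 ^ n : ℕ)) → MissingUpperBoundAt W 3) := by
  haveI : Fact (Nat.Prime 3) := ⟨Nat.prime_three⟩
  constructor
  · intro h V _ _ hr hX hs hj _ hnot
    exact h V hr hX hs hj hnot
  · intro h V _ _ hr hX hs hj hnot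
    exact h V hr hX hs hj (ClassX4.not_potMult_and_not_typeGOrd_two_of_not_towerSurj hX hs hnot).2
      hnot

/-- **X4♯(unit-free) ⟺ LOWER ∧ EXOTIC♭ ∧ TAM-DEFECT₂♭ ∧ ODD-SHA♭ ∧ MANIN♭** — additive-p4's end-state
`x4SharpUnitFree_iff_lower_and_residues_sharp` (seven named facts + GZK + modularity) with the
EXOTIC piece ALSO restricted (`♭`) to the rows that are NOT potentially good ordinary with `e = 2`:
on (G-ord, `e = 2`) at `p = 3` the tower is automatic from surj(3) (§1), so no such row is exotic.
[cite: Kato2004Asterisque, Thm. 14.5 (3) (p. 236), Thm. 17.4 (3) (p. 273)] [cite: Delbourgo1998, Prop. 4 (p. 144)]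
[cite: Wuthrich2014, Lemma 20 (p. 399), Cor. 19 (p. 398)] [cite: SilvermanAEC2009, Thm. X.4.14]
[cite: Kim2022StructureSelmer, Conj. 1.10 (PDF p. 8)] [cite: Miller2011LMS, Def. 1.1] -/
theorem x4SharpUnitFree_iff_lower_and_residues_sharp_exoticFlat
    (hCT : exists_casselsTate_pairing (K := ℚ))
    (hKatoS : Kato2004.rankZero_padicValNat_sha_le_sub_localTamagawa_of_additive_potGood_of_imageContainsSL2)
    (hDel : Delbourgo1998.prop4_rankZero_pow_dvd_constantCoeff)
    (hGZK : rank_eq_analyticRank_of_analyticRank_le_one) (hmod : hasEntireLFunction_rat)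
    (hmodD : nonempty_modularParametrizationData)
    (hL20 : Wuthrich2014.lemma20_surjective_threeAdic_of_semistable)
    (hKatoχ : Wuthrich2014.kato_halfEigenCharIdeal_dvd_cyclotomicPrime_of_surjective)
    (hK : Kato2004.charIdeal_dvd_padicLFunctionBranch_component_of_surjective) :
    X4SharpUnitFree ↔
      (∀ (W : WeierstrassCurve ℚ) [W.IsElliptic] [W.IsGloballyMinimal] (p : ℕ) [Fact p.Prime],
          W.analyticRank = 0 → ClassX4 W p → Surj W p → MissingLowerBoundAt W p) ∧
      (∀ (W : WeierstrassCurve ℚ) [W.IsElliptic] [W.IsGloballyMinimal],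
          W.analyticRank = 0 → ClassX4 W 3 → Surj W 3 → 0 ≤ padicValRat 3 W.j →
          ¬ (TypeGOrd W 3 ∧ semistabilityIndex W 3 = 2) →
          ¬ (∀ n : ℕ, W.HasSurjectiveModNGaloisRep (3 ^ n : ℕ)) → MissingUpperBoundAt W 3) ∧
      (∀ (W : WeierstrassCurve ℚ) [W.IsElliptic] [W.IsGloballyMinimal] (p : ℕ) [Fact p.Prime],
          W.analyticRank = 0 → ClassX4 W p → Surj W p → 0 ≤ padicValRat p W.j →
          ¬ (TypeGOrd W p ∧ semistabilityIndex W p = 2) →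
          padicValNat p ((W.baseChange ℚ_[p]).localTamagawaNumber ℤ_[p]) + 2 ≤
            padicValNat p W.tamagawaProduct →
          MissingUpperBoundAt W p) ∧
      (∀ (W : WeierstrassCurve ℚ) [W.IsElliptic] [W.IsGloballyMinimal] (p : ℕ) [Fact p.Prime],
          W.analyticRank = 0 → ClassX4 W p → Surj W p → 0 ≤ padicValRat p W.j →
          ¬ (TypeGOrd W p ∧ semistabilityIndex W p = 2) →
          (∃ q : ℚ, shaAn W = (q : ℂ) ∧ Odd (padicValRat p q)) → MissingUpperBoundAt W p) ∧
      (∀ (W : WeierstrassCurve ℚ) [W.IsElliptic] [W.IsGloballyMinimal] (p : ℕ) [Fact p.Prime],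
          W.analyticRank = 0 → ClassX4 W p → Surj W p → 0 ≤ padicValRat p W.j →
          ¬ (TypeGOrd W p ∧ semistabilityIndex W p = 2) →
          (∀ (N : ℕ) [NeZero N] (D : ModularParametrizationData W N), (p : ℤ) ∣ D.maninConstant) →
          MissingUpperBoundAt W p) := by
  rw [x4SharpUnitFree_iff_lower_and_residues_sharp hCT hKatoS hDel hGZK hmod hmodD hL20 hKatoχ hK,
    exotic_iff_exotic_of_not_typeGOrd_two]

end Summit.BirchSwinnertonDyer.Rank1Residual.Additive

end
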